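import Summits.QuantumFields.BalabanUV.Beta.RemainderCouplingHolomorphySq

/-!
# EriceRemainderEnclosureHolomorphyVariables — (E17) THE TWO VARIABLES OF THE ANALYTIC ALTERNATIVE, ORDERED: (D4-J8)'s hypothesis
# (uniform (ρ, M) holomorphy in g²) IMPLIES (D4-J5)'s (in g) with the explicit radius √(γ₀² + ρ) − γ₀ — hence (D4-J7)'s all-orders
# clause — and the converse FAILS: the LINEAR Markov family c·g_k meets (D4-J5)'s hypothesis for every radius and has the JUNCTION,
# but has no (AF-2) constant and no (D4-J8) extension for any (ρ, M): the square is load-bearing for (AF-2), idle for the junction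

Cell `pub-balaban`, β-function sub-cell, BINDER row D4 «RemainderConst leaves for Bałaban's split» (`HOME/BINDER-OWNERS.md`; owner
lineage `b2b-balaban-beta-an4`; this file by co-owner #2 lineage `b2b-balaban-beta-d4-p2` (MODEL crew), generation 23), β-FLOW TEAM
duty (1) under the coordinator rulings «YM REDIRECT TOWARDS THE SUMMIT» (FREEZE (0) honoured: def-free module in the lineage's own
`EriceRemainderEnclosure*` series; no leaf, no interface, no folklore-algebra module) and «YM ACCELERATION».  OCCASION: the row
OWNER's (D4-J5) `RemainderCouplingHolomorphy` (p292106), (D4-J7) `RemainderCouplingHolomorphyAllOrders` (p297326) and (D4-J8)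
`RemainderCouplingHolomorphySq` (p298145) read print's «(or analytic)» ([I] p. 264 tl.25–27; mechanism p. 266 tl.33–37 «the functions
𝐄^{(j)}, β_j are analytic functions of the effective coupling constants») once in the variable g_k (J5∕J7: (AF-1), the p. 264
clause) and once in Erice's variable g_k² (J8: (AF-2), (3.73); Erice (3.62)∕(3.73) pp. 248∕250 write β_n(g_n²); [I] (1.6) p. 261
defines β_{k+1} through 𝐄^{(k+1)} at the coupling g_k²).  This file is the MODEL crew's record of how the two hypotheses sit
relative to each other and of which conclusions need the square.  Companion (E18) `EriceRemainderEnclosureHolomorphySegment`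
treats the Erice-side domain ((D4-J8) §2 without «s₀ ≤ ρ∕4»).

HONEST FRAMING (BETA-SPEC §0.2, verbatim and binding). *"Discharging BetaPertH makes Bałaban's UV stability UNCONDITIONAL — a
real constructive-QFT result; it is NOT the continuum limit and NOT the Clay problem."*  This module discharges NOTHING of the kind:
folklore complex analysis (composition with z ↦ z², the algebra of |z² − s²|) and one-variable real arithmetic on a TOY family,
against the tree's typed SHAPES `FlowStep.HBeta`, `B12Beta.OneLoopSplit` ([I] (2.12)–(2.14) p. 268), `Beta.RemainderChain.RemainderConst`,
`BetaDerivClause.LastVarDerivBound` and the (D4-J4)∕(D4-J5)∕(D4-J7)∕(D4-J8) theorems BY NAME; every holomorphic extension is a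
HYPOTHESIS; nothing of Bałaban's (1.22) is asserted, constructed or instantiated; row D4 class UNCHANGED (critical-path width 0;
instance 0∕1; D4 DISCHARGE NO DATE).  NOT BetaPertH, NOT continuum, NOT Clay.  HONEST DEPENDENCY: continuum YM on T⁴ ⇐ BetaPertH
∧ nine spine estimates (0/9 proved); BetaPertH ⇐ (D1) ∧ (D4) ∧ CAP+tail; G-an2-4 gates asym, D1 and NE2/3/4.

WHAT IS PROVED ([folklore]; 0 sorry; 0 `def`).
* §1 THE SQUARE MAP.  `sq_mem_nhdSq_of_mem_nhd` (if `ρ′(ρ′ + 2γ₀) ≤ ρ` then `z ↦ z²` maps the ρ′-neighbourhood of [0, γ₀] into the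
  ρ-neighbourhood of [0, γ₀²]: |z² − s²| = |z − s|·|z + s| < ρ′(ρ′ + 2γ₀)); `sqrtRadius_pos` ∕ `sqrtRadius_identity` ∕
  `sqrtRadius_eq_div` (ρ′ = √(γ₀² + ρ) − γ₀ = ρ∕(γ₀ + √(γ₀² + ρ)) > 0 solves ρ′(ρ′ + 2γ₀) = ρ); **`holo_of_holoSq`** ((D4-J8)'s
  [I]-side hypothesis `hHolSq` with (ρ, M) ⟹ (D4-J5)'s `hHol` with (ρ′, M) for ANY such ρ′, G(z) = F(z²); both shapes VERBATIM);
  `holo_of_holoSq_sqrtRadius`; **`p264AllOrders_of_holoSq`** ((D4-J8)'s hypothesis ⟹ (D4-J7)'s FULL p. 264 clause, constants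
  m!·M∕ρ′^m, and `LastVarDerivBound β (M∕ρ′) γ₀`, ρ′ = √(γ₀² + ρ) − γ₀ — `RemainderCouplingHolomorphyAllOrders.p264Clause_of_holo`
  BY NAME).  (D4-J8) §1 reaches (AF-1) with constant (M∕ρ)γ₀ directly — better than M∕ρ′ ≥ 2γ₀M∕ρ through §1; the detour earns
  the higher-order lines.
* §2 THE CONVERSE FAILS — THE LINEAR MARKOV FAMILY β_{k+1}(g₀,…,g_k) = c·g_k (hypothesis `hβ`, no definition).
  `linfam_β1_eq` (β¹ = c·g_k for EVERY printed split — β⁰ ≡ 0 inlined); **`linfam_holo`** ((D4-J5)'s hypothesis HOLDS for every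
  γ₀ and every radius ρ with M = |c|(γ₀ + ρ): F(z) = c·z); `linfam_af1` (|β¹| = |c|·g_k); `linfam_remainderConst`
  (`RemainderConst S γ (|c|γ)`); **`linfam_junction_explicit`** (for b > 0 and every box γ ≤ b∕(2(|c| + 1)): `RemainderConst S γ (|c|γ)`
  with |c|γ < b — the JUNCTION with γ₁ displayed); **`linfam_af2_elim`** (a quadratic bound |β¹_{k+1}| ≤ C·g_k² on ANY box, γ₀ > 0,
  forces c = 0 — already at k = 0); **`linfam_holoSq_elim`** ((D4-J8)'s hypothesis for ANY γ₀, ρ > 0, M forces c = 0 — through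
  (D4-J8) `af2_of_holoSq` BY NAME).
* END `linfam_witness` (for every c ≠ 0: β, S with all of §2 at once) — together with §1 the census: J8 (in g²) ⟹ J5∕J7 (in g)
  ⟹ R-264's first-order line ⟹ JUNCTION, the first implication STRICT, J8's extra strength spent exactly on (AF-2) ∕ (3.73) —
  the binder `hAF2` of the logarithmic one-loop law (`T4OneLoopAsymptotics` §5) is NOT reachable from (D4-J5)'s hypothesis —
  and not on (D4)'s junction.  What none supplies is unchanged: the INSTANCE (0∕1), the uniformity in the scale (necessary by (E16)),
  any sign or value of β⁰.  Class UNCHANGED.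
-/

noncomputable section

open Metric Set Complex
open scoped Nat

namespace Summit.QuantumFields.BalabanUV.Beta.EriceRemainderEnclosureHolomorphyVariables

open Literature.MathematicalPhysics.QuantumFieldTheory.Balaban1983to89
open Literature.MathematicalPhysics.QuantumFieldTheory.Balaban1983to89.FlowStep (HBeta)
open Literature.MathematicalPhysics.QuantumFieldTheory.Balaban1983to89.Beta.RemainderChain (RemainderConst)
open Literature.MathematicalPhysics.QuantumFieldTheory.Balaban1983to89.BetaDerivClause (LastVarDerivBound)
open Summit.QuantumFields.BalabanUV.Beta.RemainderConstTwoShapes (junction_of_af1)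
open Summit.QuantumFields.BalabanUV.Beta.RemainderCouplingHolomorphyAllOrders (p264Clause_of_holo)
open Summit.QuantumFields.BalabanUV.Beta.RemainderCouplingHolomorphySq (af2_of_holoSq)

variable {β : HBeta}

/-! ## §1 The square map between the two neighbourhoods; (D4-J8)'s hypothesis implies (D4-J5)'s and (D4-J7)'s clause -/

/-- **`z ↦ z²` maps the ρ′-neighbourhood of `[0, γ₀]` into the ρ-neighbourhood of `[0, γ₀²]` whenever `ρ′(ρ′ + 2γ₀) ≤ ρ`**:
for `dist z s < ρ′`, `s ∈ [0, γ₀]`: `|z² − s²| = |z − s|·|z + s| < ρ′·(ρ′ + 2γ₀)`. [folklore] -/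
theorem sq_mem_nhdSq_of_mem_nhd {γ₀ ρ ρ' : ℝ} (h : ρ' * (ρ' + 2 * γ₀) ≤ ρ) {z : ℂ}
    (hz : ∃ s : ℝ, s ∈ Icc (0 : ℝ) γ₀ ∧ dist z (s : ℂ) < ρ') :
    ∃ t : ℝ, t ∈ Icc (0 : ℝ) (γ₀ ^ 2) ∧ dist (z ^ 2) (t : ℂ) < ρ := by
  obtain ⟨s, hs, hzs⟩ := hz
  refine ⟨s ^ 2, ⟨sq_nonneg _, pow_le_pow_left₀ hs.1 hs.2 2⟩, ?_⟩
  rw [Complex.dist_eq] at hzs ⊢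
  have hfac : z ^ 2 - ((s ^ 2 : ℝ) : ℂ) = (z - s) * (z + s) := by push_cast; ring
  have h2 : ‖(2 : ℂ) * (s : ℂ)‖ = 2 * s := by
    rw [norm_mul, Complex.norm_real, Real.norm_of_nonneg hs.1]; norm_num
  have hplus : ‖z + (s : ℂ)‖ < ρ' + 2 * γ₀ := by
    calc ‖z + (s : ℂ)‖ = ‖(z - s) + 2 * (s : ℂ)‖ := by ring_nf
      _ ≤ ‖z - s‖ + ‖(2 : ℂ) * (s : ℂ)‖ := norm_add_le _ _
      _ = ‖z - s‖ + 2 * s := by rw [h2]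
      _ < ρ' + 2 * γ₀ := by linarith [hs.2]
  rw [hfac, norm_mul]
  exact (mul_lt_mul'' hzs hplus (norm_nonneg _) (norm_nonneg _)).trans_le h

/-- `√(γ₀² + ρ) − γ₀ > 0` for `γ₀ ≥ 0`, `ρ > 0`. [folklore] -/
theorem sqrtRadius_pos {γ₀ ρ : ℝ} (hγ₀ : 0 ≤ γ₀) (hρ : 0 < ρ) : 0 < Real.sqrt (γ₀ ^ 2 + ρ) - γ₀ :=
  sub_pos.mpr ((Real.lt_sqrt hγ₀).mpr (by linarith))

/-- `ρ′ = √(γ₀² + ρ) − γ₀` solves `ρ′(ρ′ + 2γ₀) = ρ` (`γ₀² + ρ ≥ 0`). [folklore] -/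
theorem sqrtRadius_identity {γ₀ ρ : ℝ} (h : 0 ≤ γ₀ ^ 2 + ρ) :
    (Real.sqrt (γ₀ ^ 2 + ρ) - γ₀) * ((Real.sqrt (γ₀ ^ 2 + ρ) - γ₀) + 2 * γ₀) = ρ := by
  have hsq := Real.sq_sqrt h
  have : (Real.sqrt (γ₀ ^ 2 + ρ) - γ₀) * ((Real.sqrt (γ₀ ^ 2 + ρ) - γ₀) + 2 * γ₀)
      = Real.sqrt (γ₀ ^ 2 + ρ) ^ 2 - γ₀ ^ 2 := by ring
  rw [this, hsq]; ring

/-- The same radius as a quotient: `√(γ₀² + ρ) − γ₀ = ρ ∕ (γ₀ + √(γ₀² + ρ))` (`γ₀ ≥ 0`, `ρ > 0`). [folklore] -/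
theorem sqrtRadius_eq_div {γ₀ ρ : ℝ} (hγ₀ : 0 ≤ γ₀) (hρ : 0 < ρ) :
    Real.sqrt (γ₀ ^ 2 + ρ) - γ₀ = ρ / (γ₀ + Real.sqrt (γ₀ ^ 2 + ρ)) := by
  have hpos : 0 < γ₀ + Real.sqrt (γ₀ ^ 2 + ρ) := by linarith [sqrtRadius_pos hγ₀ hρ]
  rw [eq_div_iff hpos.ne']
  have h := sqrtRadius_identity (by positivity : 0 ≤ γ₀ ^ 2 + ρ)
  linarith [h, show (Real.sqrt (γ₀ ^ 2 + ρ) - γ₀) * ((Real.sqrt (γ₀ ^ 2 + ρ) - γ₀) + 2 * γ₀)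
      = (Real.sqrt (γ₀ ^ 2 + ρ) - γ₀) * (γ₀ + Real.sqrt (γ₀ ^ 2 + ρ)) by ring]

/-- **(D4-J8)'s [I]-SIDE HYPOTHESIS ⟹ (D4-J5)'s, for every radius ρ′ > 0 with `ρ′(ρ′ + 2γ₀) ≤ ρ`, same bound M**: if
`w ↦ F(w)` is complex-differentiable on the ρ-neighbourhood of [0, γ₀²] with ‖F‖ ≤ M and F(g²) = β_{k+1}(…, g), then `G(z) = F(z²)` is
complex-differentiable on the ρ′-neighbourhood of [0, γ₀] with ‖G‖ ≤ M and G(g) = β_{k+1}(…, g).  The hypothesis shapes are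
(D4-J8)'s `hHolSq` and (D4-J5)'s `hHol` VERBATIM. [cite: Balaban1987RG1, §2 p.266 tl.33–37 — shapes only, nothing asserted] -/
theorem holo_of_holoSq {γ₀ ρ ρ' M : ℝ} (h : ρ' * (ρ' + 2 * γ₀) ≤ ρ)
    (hHolSq : ∀ (k : ℕ) (p : Fin (k + 1) → ℝ), p ∈ B12Beta.HistBox γ₀ k → ∃ F : ℂ → ℂ,
      DifferentiableOn ℂ F {z : ℂ | ∃ s : ℝ, s ∈ Icc (0 : ℝ) (γ₀ ^ 2) ∧ dist z (s : ℂ) < ρ} ∧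
      (∀ z : ℂ, (∃ s : ℝ, s ∈ Icc (0 : ℝ) (γ₀ ^ 2) ∧ dist z (s : ℂ) < ρ) → ‖F z‖ ≤ M) ∧
      ∀ g : ℝ, g ∈ Icc (0 : ℝ) γ₀ → F (((g ^ 2 : ℝ)) : ℂ) = (β k (Function.update p (Fin.last k) g) : ℂ)) :
    ∀ (k : ℕ) (p : Fin (k + 1) → ℝ), p ∈ B12Beta.HistBox γ₀ k → ∃ G : ℂ → ℂ,
      DifferentiableOn ℂ G {z : ℂ | ∃ s : ℝ, s ∈ Icc (0 : ℝ) γ₀ ∧ dist z (s : ℂ) < ρ'} ∧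
      (∀ z : ℂ, (∃ s : ℝ, s ∈ Icc (0 : ℝ) γ₀ ∧ dist z (s : ℂ) < ρ') → ‖G z‖ ≤ M) ∧
      ∀ g : ℝ, g ∈ Icc (0 : ℝ) γ₀ → G (g : ℂ) = (β k (Function.update p (Fin.last k) g) : ℂ) := by
  intro k p hp
  obtain ⟨F, hdiff, hM, hF⟩ := hHolSq k p hp
  refine ⟨fun z => F (z ^ 2), ?_, fun z hz => hM _ (sq_mem_nhdSq_of_mem_nhd h hz), fun g hg => ?_⟩
  · have hsq : DifferentiableOn ℂ (fun z : ℂ => z ^ 2) {z : ℂ | ∃ s : ℝ, s ∈ Icc (0 : ℝ) γ₀ ∧ dist z (s : ℂ) < ρ'} :=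
      (differentiable_pow 2).differentiableOn
    exact hdiff.comp hsq fun z hz => sq_mem_nhdSq_of_mem_nhd h hz
  · have h1 := hF g hg
    rw [Complex.ofReal_pow] at h1
    exact h1

/-- **(D4-J8)'s hypothesis (ρ, M) ⟹ (D4-J5)'s with the EXPLICIT radius `√(γ₀² + ρ) − γ₀` and the same M** (`ρ ≥ 0`).
[cite: Balaban1987RG1, §2 p.266 tl.33–37 — shapes only, nothing asserted] -/
theorem holo_of_holoSq_sqrtRadius {γ₀ ρ M : ℝ} (hρ : 0 ≤ ρ)
    (hHolSq : ∀ (k : ℕ) (p : Fin (k + 1) → ℝ), p ∈ B12Beta.HistBox γ₀ k → ∃ F : ℂ → ℂ,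
      DifferentiableOn ℂ F {z : ℂ | ∃ s : ℝ, s ∈ Icc (0 : ℝ) (γ₀ ^ 2) ∧ dist z (s : ℂ) < ρ} ∧
      (∀ z : ℂ, (∃ s : ℝ, s ∈ Icc (0 : ℝ) (γ₀ ^ 2) ∧ dist z (s : ℂ) < ρ) → ‖F z‖ ≤ M) ∧
      ∀ g : ℝ, g ∈ Icc (0 : ℝ) γ₀ → F (((g ^ 2 : ℝ)) : ℂ) = (β k (Function.update p (Fin.last k) g) : ℂ)) :
    ∀ (k : ℕ) (p : Fin (k + 1) → ℝ), p ∈ B12Beta.HistBox γ₀ k → ∃ G : ℂ → ℂ,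
      DifferentiableOn ℂ G {z : ℂ | ∃ s : ℝ, s ∈ Icc (0 : ℝ) γ₀ ∧ dist z (s : ℂ) < Real.sqrt (γ₀ ^ 2 + ρ) - γ₀} ∧
      (∀ z : ℂ, (∃ s : ℝ, s ∈ Icc (0 : ℝ) γ₀ ∧ dist z (s : ℂ) < Real.sqrt (γ₀ ^ 2 + ρ) - γ₀) → ‖G z‖ ≤ M) ∧
      ∀ g : ℝ, g ∈ Icc (0 : ℝ) γ₀ → G (g : ℂ) = (β k (Function.update p (Fin.last k) g) : ℂ) :=
  holo_of_holoSq (le_of_eq (sqrtRadius_identity (by positivity))) hHolSq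

/-- **(D4-J8)'s HYPOTHESIS ⟹ (D4-J7)'s FULL p. 264 CLAUSE with constants `m!·M∕ρ′^m` and `LastVarDerivBound β (M∕ρ′) γ₀`,
`ρ′ = √(γ₀² + ρ) − γ₀`** — `RemainderCouplingHolomorphyAllOrders.p264Clause_of_holo` BY NAME on §1's extension.  So uniform
holomorphy in g² is the STRONGER reading: it enters every line of the all-orders route.  [cite: Balaban1987RG1, §1 p.264 tl.25–27
and §2 p.266 tl.33–37 — shapes only, nothing asserted] -/
theorem p264AllOrders_of_holoSq {γ₀ ρ M : ℝ} (hγ₀ : 0 < γ₀) (hρ : 0 < ρ)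
    (hHolSq : ∀ (k : ℕ) (p : Fin (k + 1) → ℝ), p ∈ B12Beta.HistBox γ₀ k → ∃ F : ℂ → ℂ,
      DifferentiableOn ℂ F {z : ℂ | ∃ s : ℝ, s ∈ Icc (0 : ℝ) (γ₀ ^ 2) ∧ dist z (s : ℂ) < ρ} ∧
      (∀ z : ℂ, (∃ s : ℝ, s ∈ Icc (0 : ℝ) (γ₀ ^ 2) ∧ dist z (s : ℂ) < ρ) → ‖F z‖ ≤ M) ∧
      ∀ g : ℝ, g ∈ Icc (0 : ℝ) γ₀ → F (((g ^ 2 : ℝ)) : ℂ) = (β k (Function.update p (Fin.last k) g) : ℂ)) :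
    (∀ (k : ℕ) (p : Fin (k + 1) → ℝ), p ∈ B12Beta.HistBox γ₀ k →
      ContDiffOn ℝ ⊤ (fun s : ℝ => β k (Function.update p (Fin.last k) s)) (Icc (0 : ℝ) γ₀) ∧
      (∀ g : ℝ, g ∈ Icc (0 : ℝ) γ₀ → |β k (Function.update p (Fin.last k) g)| ≤ M) ∧
      ∀ (m : ℕ) (g : ℝ), g ∈ Icc (0 : ℝ) γ₀ →
        |iteratedDerivWithin m (fun s : ℝ => β k (Function.update p (Fin.last k) s)) (Icc (0 : ℝ) γ₀) g|
          ≤ m ! * M / (Real.sqrt (γ₀ ^ 2 + ρ) - γ₀) ^ m) ∧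
    LastVarDerivBound β (M / (Real.sqrt (γ₀ ^ 2 + ρ) - γ₀)) γ₀ :=
  p264Clause_of_holo (holo_of_holoSq_sqrtRadius hρ.le hHolSq) hγ₀ (sqrtRadius_pos hγ₀.le hρ)

/-! ## §2 The converse fails: the linear Markov family `β_{k+1} = c·g_k` -/

section LinFam

variable {c : ℝ} (hβ : ∀ (k : ℕ) (p : Fin (k + 1) → ℝ), β k p = c * p (Fin.last k))
include hβ

/-- `β¹_{k+1}(p) = c·g_k` for EVERY printed split: the split at the zero history with (2.14) vanishing gives β⁰ ≡ 0 (the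
sentence «every split has one-loop part 0» is d4-p3's `RemainderExplicitScaleDrift.split_β0_eq_zero` shape, inlined here for this
carrier), then the split at `p`. [folklore] -/
theorem linfam_β1_eq (S : B12Beta.OneLoopSplit β) (k : ℕ) (p : Fin (k + 1) → ℝ) : S.β1 k p = c * p (Fin.last k) := by
  have h0 : S.β0 k = 0 := by
    have h := S.split k (fun _ => 0)
    rw [S.vanish k _ rfl, hβ k] at h
    simpa using h.symm
  have h := S.split k p
  rw [h0, zero_add, hβ k p] at h
  exact h.symm

/-- **(D4-J5)'s HYPOTHESIS HOLDS for the linear family, for EVERY `γ₀` and EVERY radius `ρ`, with `M = |c|(γ₀ + ρ)`**: `F(z) = c·z` is entire,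
`‖c·z‖ ≤ |c|(γ₀ + ρ)` on the ρ-neighbourhood of [0, γ₀], and `F(g) = β_{k+1}(…, g)`.  So (D4-J5)∕(D4-J7) apply: (AF-1) with
`M∕ρ′`, the junction, the all-orders clause. [cite: Balaban1987RG1, §2 p.266 — shape only, nothing asserted] -/
theorem linfam_holo (γ₀ ρ : ℝ) :
    ∀ (k : ℕ) (p : Fin (k + 1) → ℝ), p ∈ B12Beta.HistBox γ₀ k → ∃ F : ℂ → ℂ,
      DifferentiableOn ℂ F {z : ℂ | ∃ s : ℝ, s ∈ Icc (0 : ℝ) γ₀ ∧ dist z (s : ℂ) < ρ} ∧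
      (∀ z : ℂ, (∃ s : ℝ, s ∈ Icc (0 : ℝ) γ₀ ∧ dist z (s : ℂ) < ρ) → ‖F z‖ ≤ |c| * (γ₀ + ρ)) ∧
      ∀ g : ℝ, g ∈ Icc (0 : ℝ) γ₀ → F (g : ℂ) = (β k (Function.update p (Fin.last k) g) : ℂ) := by
  intro k p _
  have hd : Differentiable ℂ fun z : ℂ => (c : ℂ) * z := by fun_prop
  refine ⟨fun z => (c : ℂ) * z, hd.differentiableOn, fun z ⟨s, hs, hzs⟩ => ?_, fun g _ => ?_⟩
  · rw [norm_mul, Complex.norm_real, Real.norm_eq_abs]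
    refine mul_le_mul_of_nonneg_left ?_ (abs_nonneg c)
    rw [Complex.dist_eq] at hzs
    calc ‖z‖ = ‖(z - s) + (s : ℂ)‖ := by ring_nf
      _ ≤ ‖z - s‖ + ‖(s : ℂ)‖ := norm_add_le _ _
      _ ≤ ρ + γ₀ := by rw [Complex.norm_real, Real.norm_of_nonneg hs.1]; linarith [hs.2]
      _ = γ₀ + ρ := add_comm _ _
  · rw [hβ k, Function.update_self]; push_cast; ring

/-- (AF-1) with the honest constant `|c|` — an EQUALITY `|β¹_{k+1}(p)| = |c|·g_k` for `g_k ≥ 0`. [folklore] -/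
theorem linfam_af1 (S : B12Beta.OneLoopSplit β) (k : ℕ) (p : Fin (k + 1) → ℝ) (hp : 0 ≤ p (Fin.last k)) :
    |S.β1 k p| = |c| * p (Fin.last k) := by
  rw [linfam_β1_eq hβ S k p, abs_mul, abs_of_nonneg hp]

/-- `RemainderConst S γ (|c|·γ)` on every box `γ ≥ 0`. [folklore] -/
theorem linfam_remainderConst (S : B12Beta.OneLoopSplit β) {γ : ℝ} : RemainderConst S γ (|c| * γ) := fun k p hp => by
  have h := hp (Fin.last k)
  rw [linfam_af1 hβ S k p h.1.le]
  exact mul_le_mul_of_nonneg_left h.2 (abs_nonneg c)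

/-- **THE JUNCTION HOLDS, γ₁ DISPLAYED**: for every `b > 0` and every box `γ ≤ b∕(2(|c| + 1))`: `RemainderConst S γ (|c|γ)` with
`|c|γ < b`.  (The square is NOT needed for (D4)'s junction.) [folklore] -/
theorem linfam_junction_explicit (S : B12Beta.OneLoopSplit β) {b : ℝ} (hb : 0 < b) {γ : ℝ}
    (hγ₁ : γ ≤ b / (2 * (|c| + 1))) : RemainderConst S γ (|c| * γ) ∧ |c| * γ < b := by
  refine ⟨linfam_remainderConst hβ S, ?_⟩
  have hc1 : 0 < |c| + 1 := by positivity
  calc |c| * γ ≤ |c| * (b / (2 * (|c| + 1))) := mul_le_mul_of_nonneg_left hγ₁ (abs_nonneg c)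
    _ ≤ (|c| + 1) * (b / (2 * (|c| + 1))) := mul_le_mul_of_nonneg_right (le_add_of_nonneg_right zero_le_one) (by positivity)
    _ = b / 2 := by field_simp
    _ < b := half_lt_self hb

/-- **(AF-2) ELIMINATION: a quadratic remainder bound on any box forces `c = 0`.**  If `|β¹_{k+1}(p)| ≤ C·g_k²` on ]0,γ₀]^{k+1}
(γ₀ > 0) for all scales — already for `k = 0` — then `c = 0`: at the constant history `g = min(γ₀, |c|∕(2(|C|+1)))`,
`|c|·g ≤ C·g²` gives `|c| ≤ |C|·g ≤ |c|∕2`.  So for `c ≠ 0` the family has (AF-1) and the junction but NO (AF-2) constant: the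
binder `hAF2` of `T4OneLoopAsymptotics.abs_invSq_bare_sub_oneLoop_le_log` is not reachable from (D4-J5)'s hypothesis. [folklore] -/
theorem linfam_af2_elim (S : B12Beta.OneLoopSplit β) {γ₀ C : ℝ} (hγ₀ : 0 < γ₀)
    (hAF2 : ∀ (k : ℕ) (p : Fin (k + 1) → ℝ), p ∈ B12Beta.HistBox γ₀ k → |S.β1 k p| ≤ C * p (Fin.last k) ^ 2) :
    c = 0 := by
  by_contra hc
  have hc' : 0 < |c| := abs_pos.mpr hc
  have hCp : 0 < |C| + 1 := by positivity
  set g : ℝ := min γ₀ (|c| / (2 * (|C| + 1))) with hg_def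
  have hgpos : 0 < g := lt_min hγ₀ (by positivity)
  have hgγ : g ≤ γ₀ := min_le_left _ _
  have hgc : g ≤ |c| / (2 * (|C| + 1)) := min_le_right _ _
  have h := hAF2 0 (fun _ => g) (fun _ => ⟨hgpos, hgγ⟩)
  rw [linfam_af1 hβ S 0 _ hgpos.le] at h
  -- h : |c| * g ≤ C * g ^ 2
  have h2 : |c| ≤ C * g := by
    rw [sq, ← mul_assoc] at h
    exact le_of_mul_le_mul_right h hgpos
  have h3 : C * g ≤ |C| * g := mul_le_mul_of_nonneg_right (le_abs_self C) hgpos.le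
  have h4 : |C| * g ≤ |C| * (|c| / (2 * (|C| + 1))) := mul_le_mul_of_nonneg_left hgc (abs_nonneg C)
  have h5 : |C| * (|c| / (2 * (|C| + 1))) < |c| / 2 := by
    have hlt : |C| / (|C| + 1) < 1 := (div_lt_one hCp).mpr (lt_add_one _)
    calc |C| * (|c| / (2 * (|C| + 1))) = (|c| / 2) * (|C| / (|C| + 1)) := by field_simp
      _ < (|c| / 2) * 1 := mul_lt_mul_of_pos_left hlt (by positivity)
      _ = |c| / 2 := mul_one _
  linarith

/-- **(D4-J8)'s HYPOTHESIS ELIMINATION: uniform holomorphy in g² (any γ₀, ρ > 0, any M) forces `c = 0`** — (D4-J8)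
`RemainderCouplingHolomorphySq.af2_of_holoSq` BY NAME gives (AF-2) with constant M∕ρ, and `linfam_af2_elim` concludes.  So for
`c ≠ 0`: (D4-J5)'s hypothesis holds (`linfam_holo`, every ρ) while (D4-J8)'s fails for every (ρ, M) — uniform holomorphy in g does
NOT imply uniform holomorphy in g²; §1's implication is STRICT. [cite: Balaban1987RG1, §2 p.266 — shapes only, nothing asserted] -/
theorem linfam_holoSq_elim (S : B12Beta.OneLoopSplit β) {γ₀ ρ M : ℝ} (hγ₀ : 0 < γ₀) (hρ : 0 < ρ)
    (hHolSq : ∀ (k : ℕ) (p : Fin (k + 1) → ℝ), p ∈ B12Beta.HistBox γ₀ k → ∃ F : ℂ → ℂ,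
      DifferentiableOn ℂ F {z : ℂ | ∃ s : ℝ, s ∈ Icc (0 : ℝ) (γ₀ ^ 2) ∧ dist z (s : ℂ) < ρ} ∧
      (∀ z : ℂ, (∃ s : ℝ, s ∈ Icc (0 : ℝ) (γ₀ ^ 2) ∧ dist z (s : ℂ) < ρ) → ‖F z‖ ≤ M) ∧
      ∀ g : ℝ, g ∈ Icc (0 : ℝ) γ₀ → F (((g ^ 2 : ℝ)) : ℂ) = (β k (Function.update p (Fin.last k) g) : ℂ)) :
    c = 0 :=
  linfam_af2_elim hβ S hγ₀ (af2_of_holoSq hHolSq S hρ)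

end LinFam

/-- A printed split with one-loop part `0` EXISTS for the linear family. [folklore] -/
theorem linfam_split_exists {c : ℝ} (hβ : ∀ (k : ℕ) (p : Fin (k + 1) → ℝ), β k p = c * p (Fin.last k)) :
    ∃ S : B12Beta.OneLoopSplit β, ∀ k, S.β0 k = 0 :=
  ⟨⟨fun _ => 0, β, fun k p => by ring, fun k p hp => by rw [hβ k p, hp]; simp⟩, fun _ => rfl⟩

/-! ## END -/

/-- **END — THE LINEAR WITNESS, PACKAGED: for every `c ≠ 0` a history family with printed split such that** (i) it IS the linear
family; (ii) (D4-J5)'s hypothesis holds for EVERY γ₀ and EVERY radius ρ with M = |c|(γ₀ + ρ); (iii) `RemainderConst S γ (|c|γ)` on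
every box; (iv) the JUNCTION shape of (D4) holds ((D4-J4) `junction_of_af1` with C = |c|); (v) NO (AF-2) constant exists on any box
]0,γ₀]^{k+1}, γ₀ > 0; (vi) (D4-J8)'s hypothesis FAILS for every γ₀, ρ > 0 and M.  With §1: J8's hypothesis ⟹ J5's ⟹ (D4-J7)'s
clause ⟹ junction, the first arrow strict, its extra content = (AF-2).  [cite: Balaban1987RG1, §2 p.266 tl.33–37 and (2.12)–(2.14)
p.268 — shapes only, nothing asserted] -/
theorem linfam_witness {c : ℝ} (hc : c ≠ 0) :
    ∃ (β : HBeta) (S : B12Beta.OneLoopSplit β),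
      (∀ (k : ℕ) (p : Fin (k + 1) → ℝ), β k p = c * p (Fin.last k)) ∧
      (∀ (γ₀ ρ : ℝ) (k : ℕ) (p : Fin (k + 1) → ℝ), p ∈ B12Beta.HistBox γ₀ k → ∃ F : ℂ → ℂ,
          DifferentiableOn ℂ F {z : ℂ | ∃ s : ℝ, s ∈ Icc (0 : ℝ) γ₀ ∧ dist z (s : ℂ) < ρ} ∧
          (∀ z : ℂ, (∃ s : ℝ, s ∈ Icc (0 : ℝ) γ₀ ∧ dist z (s : ℂ) < ρ) → ‖F z‖ ≤ |c| * (γ₀ + ρ)) ∧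
          ∀ g : ℝ, g ∈ Icc (0 : ℝ) γ₀ → F (g : ℂ) = (β k (Function.update p (Fin.last k) g) : ℂ)) ∧
      (∀ γ : ℝ, RemainderConst S γ (|c| * γ)) ∧
      (∀ b : ℝ, 0 < b → ∃ γ₁ : ℝ, 0 < γ₁ ∧ ∀ γ : ℝ, 0 < γ → γ ≤ γ₁ →
        ∃ r : ℝ, 0 ≤ r ∧ r < b ∧ RemainderConst S γ r) ∧
      (∀ (γ₀ C : ℝ), 0 < γ₀ →
        ¬ (∀ (k : ℕ) (p : Fin (k + 1) → ℝ), p ∈ B12Beta.HistBox γ₀ k → |S.β1 k p| ≤ C * p (Fin.last k) ^ 2)) ∧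
      (∀ (γ₀ ρ M : ℝ), 0 < γ₀ → 0 < ρ →
        ¬ (∀ (k : ℕ) (p : Fin (k + 1) → ℝ), p ∈ B12Beta.HistBox γ₀ k → ∃ F : ℂ → ℂ,
          DifferentiableOn ℂ F {z : ℂ | ∃ s : ℝ, s ∈ Icc (0 : ℝ) (γ₀ ^ 2) ∧ dist z (s : ℂ) < ρ} ∧
          (∀ z : ℂ, (∃ s : ℝ, s ∈ Icc (0 : ℝ) (γ₀ ^ 2) ∧ dist z (s : ℂ) < ρ) → ‖F z‖ ≤ M) ∧
          ∀ g : ℝ, g ∈ Icc (0 : ℝ) γ₀ → F (((g ^ 2 : ℝ)) : ℂ) = (β k (Function.update p (Fin.last k) g) : ℂ))) := by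
  let β : HBeta := fun k p => c * p (Fin.last k)
  have hβ : ∀ (k : ℕ) (p : Fin (k + 1) → ℝ), β k p = c * p (Fin.last k) := fun _ _ => rfl
  obtain ⟨S, -⟩ := linfam_split_exists hβ
  exact ⟨β, S, hβ, fun γ₀ ρ => linfam_holo hβ γ₀ ρ, fun γ => linfam_remainderConst hβ S,
    junction_of_af1 S (abs_nonneg c) one_pos (fun k p hp => (linfam_af1 hβ S k p (hp (Fin.last k)).1.le).le),
    fun γ₀ C hγ₀ hAF2 => hc (linfam_af2_elim hβ S hγ₀ hAF2),
    fun γ₀ ρ M hγ₀ hρ hHolSq => hc (linfam_holoSq_elim hβ S hγ₀ hρ hHolSq)⟩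

end Summit.QuantumFields.BalabanUV.Beta.EriceRemainderEnclosureHolomorphyVariables

end
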